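import Summits.CriticalPhenomena.PercolationContinuityZ3.Theorems.Transplant.SkelPhiFaceNumsFootS
import Summits.CriticalPhenomena.PercolationContinuityZ3.Theorems.Transplant.SkelPhiFaceNumsFoot
import Summits.CriticalPhenomena.PercolationContinuityZ3.Theorems.Transplant.SkelPhiFaceDataNbS
import Summits.CriticalPhenomena.PercolationContinuityZ3.Theorems.Transplant.SkelPhiFaceDataNb
import Summits.CriticalPhenomena.PercolationContinuityZ3.Theorems.Transplant.SkelPhiFaceTargetMM
import Literature.Probability.Percolation.OrientedHistorySiteRenormalizationRun
import Summits.CriticalPhenomena.PercolationContinuityZ3.Theorems.Transplant.SkelPhiCellsSmallMS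
import Summits.CriticalPhenomena.PercolationContinuityZ3.Theorems.Transplant.SkelPhiFaceRouteReadingsS
import Summits.CriticalPhenomena.PercolationContinuityZ3.Theorems.Transplant.PlanarCells2SDefs
import HarnessLib
/-!
# N2 (frames-only node `SamePDropOfSkeletonFrm₁`, OPEN) — WAVE 1, (F) face-data column over STAGGERED cells ((R-22) `PCells2S`, (R-28)(β) one landing per file): the twin of N1's `SkelPhiFaceTargetMM`

builds on p205010 (kernel theorem, internal audit signed; external expert review pending) — nothing in this file uses p205010; NOTHING is claimed about the
open node `SamePDropOfSkeletonFrm₁` (`SamePDropOfSkeletonNeg₁` is CLOSED in the tree and untouched by this file).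
Status sentence (coordinator 2026-08-20T04:30Z): "θ(p_c) = 0 on ℤ^d, all d ≥ 2 — kernel-verified (Lean 4/Mathlib, standard axioms); internal adversarial
audit SIGNED 2026-08-20 04:29Z; external expert review pending."
Lane `prim-bschramm`, seat `prim-hp-8` (gen 40); helper file (`--supports stmt-CriticalPhenomena-4575 --as helper`); design owner p3-g15 ((R-22) staggered
cells `PCells2S`, (R-27)/(R-29) far regions of record `FarNS/FarNS₂`, (R-28)(β), naming 2026-08-22T23:00:04Z: suffix `S`).
PORT RULES (HOME/prim-hp-8/code/gen40/orient/bin/port_s.py = stmt-g19's port_orient.py + the G token table): the cells are `P : PCells2S`, every box is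
read about the STAGGERED centre `cenS` (`PlanarCells2SDefs/SFar/ContainS/SArm/SepS/SepInfS/LevelsS/EfarN2S`), the scheme record is `cellGeomSG₂S`/`cellGeomSG₂bS`
(`SkelPhiCellsWeakGS/…SmallMS`: narrow arm `BtwNS`, two-block far region `FarNS₂`), the history-site API is the ORIENTED one at `qNE` where it occurs
(`ochoice qNE`, `onwardO`, `Valid₂O`, `IsRun₂O`, …, (R-18)); EVERY declaration is re-declared with the suffix `S` (same namespace). Docstrings/citations are N1's.
N1 HEADER (kept for the reader):
* `Skelφ.cell_mem_Mb_of_footBox`, `not_mem_MbWinW_of_near`, def **`targetMM`**, `targetMM_subset_T`, `disjoint_targetMM_of_near`, **`mem_targetMM_of_footBox`**,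
  `PCells2.Mb_thick_mem_farAS₂`.
[cite: KozmaNitzan2024, §4 p. 26 (M_v), p. 30 (Step III), Lemma 11 (p. 22)]
-/
noncomputable section

open scoped Classical

namespace Summit.CriticalPhenomena.PercolationContinuityZ3.Theorems.Transplant

namespace Skelφ

open Literature.Probability.Percolation Literature.Probability.LatticeModels KNCells
open Literature.Probability.Percolation.KozmaNitzan
open Literature.Probability.Percolation.KozmaNitzan.Cells (oth oth_ne sgOf sgOf_sign stepVec_apply_fst stepVec_apply_oth eq_oth_of_ne oth_oth)
open Literature.Barriers.CriticalPhenomena (graphBall graphBall_mono)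
open BoxProdZ2 (ConcRadiiG)
open Skel (WinStepData)

variable {V : Type} [DecidableEq V] {G : SimpleGraph V} [G.LocallyFinite] {φ : V → Site 2}

/-! ## §1 Footprint ⟹ the cell lies in `Mb` (no graph facts) -/

omit [DecidableEq V] [G.LocallyFinite] in
/-- The cell of a vertex whose base-`c` footprint lands, after the shift by the contact's cell, inside `cen (x+du) ± (b₀ − 2)` lies in `Mb b₀ (x+du)`
(indeed within `b₀ − 1`). [folklore] -/
theorem cell_mem_Mb_of_footBoxS (P : PCells2S) (t₀ c : V) (A n h vα vβ c₀ c₁ : ℤ) {D : ℤ} (hD : 0 < D) {x : Site 2} {du : MDir}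
    {b₀ : Fin 2 → ℕ} {glo ghi gw : ℤ} {w : V} (hfb : FootBox glo ghi gw du (fineSkel φ c A n h vα vβ c₀ c₁ (D / 2) (D / 2) D w))
    (hpar : ∀ s : ℤ, glo ≤ s → s ≤ ghi →
      |sgOf du * s + fineSkel φ t₀ A n h vα vβ c₀ c₁ (D / 2) (D / 2) D c du.1 - P.cenS (x + stepVec du) du.1| + 2 ≤ b₀ du.1)
    (hperp : gw + |fineSkel φ t₀ A n h vα vβ c₀ c₁ (D / 2) (D / 2) D c (oth du.1) - P.cenS (x + stepVec du) (oth du.1)| + 2 ≤ b₀ (oth du.1)) :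
    ∀ i, |fineSkel φ t₀ A n h vα vβ c₀ c₁ (D / 2) (D / 2) D w i - P.cenS (x + stepVec du) i| + 1 ≤ b₀ i := by
  set FS := fineSkel φ t₀ A n h vα vβ c₀ c₁ (D / 2) (D / 2) D with hFS
  set zr := fineSkel φ c A n h vα vβ c₀ c₁ (D / 2) (D / 2) D w with hzr
  have hbc : ∀ i, |FS w i - (zr i + FS c i)| ≤ 1 := fun i => abs_fineSkel_base_change t₀ c w A n h vα vβ c₀ c₁ hD i
  obtain ⟨hf1, hf2, hf3⟩ := hfb
  have hsg := sgOf_sign du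
  intro i
  by_cases hi : i = du.1
  · subst hi
    have hp := hpar (sgOf du * zr du.1) hf1 hf2
    have hs2 : sgOf du * (sgOf du * zr du.1) = zr du.1 := by rcases hsg with hs | hs <;> rw [hs] <;> ring
    rw [hs2] at hp
    have h1 := abs_le.1 (hbc du.1)
    have hq := abs_le.1 (show |zr du.1 + FS c du.1 - P.cenS (x + stepVec du) du.1| ≤ b₀ du.1 - 2 by linarith)
    have : |FS w du.1 - P.cenS (x + stepVec du) du.1| ≤ b₀ du.1 - 1 := by rw [abs_le]; constructor <;> linarith
    linarith
  · rw [eq_oth_of_ne hi]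
    have h1 := abs_le.1 (hbc (oth du.1))
    have h3 := abs_le.1 hf3
    have hq := abs_le.1 (show |FS c (oth du.1) - P.cenS (x + stepVec du) (oth du.1)| ≤ b₀ (oth du.1) - 2 - gw by linarith)
    have : |FS w (oth du.1) - P.cenS (x + stepVec du) (oth du.1)| ≤ b₀ (oth du.1) - 1 := by rw [abs_le]; constructor <;> linarith
    linarith

omit [DecidableEq V] in
/-- Near vertices are off the cell-map window over `Mb b₀ (x+du)` (the `Win` version of `not_mem_MbWin_of_nearS`). [folklore] -/
theorem not_mem_MbWinW_of_nearS (P : PCells2S) (w₀ c : V) (A n h vα vβ c₀ c₁ : ℤ) {D : ℤ} (hD : 0 < D) {x : Site 2} {du : MDir} {b₀ : Fin 2 → ℕ}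
    {R : ℕ} {k Lc : ℤ} {v : V} (hk : |fineSkel φ c A n h vα vβ c₀ c₁ (D / 2) (D / 2) D v du.1| ≤ k)
    (hLc : P.lev du x (fineSkel φ w₀ A n h vα vβ c₀ c₁ (D / 2) (D / 2) D c) ≤ Lc) (hfar : Lc + k + 1 < 20 * (P.r du.1 : ℤ) - b₀ du.1) :
    v ∉ Win G (fineSkel φ w₀ A n h vα vβ c₀ c₁ (D / 2) (D / 2) D) w₀ (P.Mb b₀ (x + stepVec du)) R := by
  intro hv
  have hW := (mem_Win G _).1 hv
  have hM := (PCells2S.mem_Mb_iff (P := P)).1 hW.2 du.1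
  have hbc := abs_le.1 (abs_fineSkel_base_change (φ := φ) w₀ c v A n h vα vβ c₀ c₁ hD du.1)
  have hk' := abs_le.1 hk
  have hcen := P.lev_cen_add_stepVec x du
  unfold PCells2S.lev at hLc hcen
  rcases sgOf_sign du with hs | hs <;> rw [hs] at hLc hcen <;> nlinarith [hM.1, hM.2, hbc.1, hbc.2, hk'.1, hk'.2]

/-! ## §2 The history-free target -/

variable (G) (φ) (pr : FinePrm) (P : PCells2S) (w₀ : V) (Λ : ConcRadiiG) (b₀ : Fin 2 → ℕ)

/-- **THE HISTORY-FREE TARGET** `M_{a'}(x+du) ∪ RimG` of the face route at `(a', x, du)` (rim depth `L′`). [this work] -/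
def targetMMS (a' : ℕ) (x : Site 2) (du : MDir) (L' : ℕ) : Finset V :=
  (cellGeomSG₂bS G (pr.ψ φ w₀) P w₀ Λ b₀).M a' (x + stepVec du) ∪
    (Win G (pr.ψ φ w₀) w₀ (P.Mb b₀ (x + stepVec du)) (Λ.rE a' x du)).filter
      fun w => w ∉ graphBall G w₀ (Λ.rM a' (x + stepVec du) - L')

variable {G φ pr P w₀ Λ b₀}

/-- **`targetMMS ⊆ T`** of the face step, given the habitat inclusion of the window over `Mb`. [folklore] -/
theorem targetMM_subset_TS {b : Fin 2} {a' : ℕ} {x : Site 2} {du : MDir} {j : ℕ} {pc : ℤ} {aw Rlev N M L' : ℕ} {Sfin : Finset V}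
    (hWin : Win G (pr.ψ φ w₀) w₀ (P.Mb b₀ (x + stepVec du)) (Λ.rE a' x du) ⊆
      stepRg G (pr.frame φ w₀ du.1 b) (faceStepWNbS G pr φ P w₀ Λ b₀ b a' x du j pc aw Rlev N M L' Sfin)) :
    targetMMS G φ pr P w₀ Λ b₀ a' x du L' ⊆ (faceStepWNbS G pr φ P w₀ Λ b₀ b a' x du j pc aw Rlev N M L' Sfin).T := by
  intro w hw
  rw [faceStepWNb_TS]
  rcases Finset.mem_union.1 hw with h | h
  · exact Finset.mem_union_left _ h
  · obtain ⟨h1, h2⟩ := Finset.mem_filter.1 h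
    exact Finset.mem_union_right _ (Finset.mem_filter.2 ⟨hWin h1, h2⟩)

/-- **`targetMMS ∩ (near set) = ∅`**: vertices whose base-`c` cell coordinate on the face's axis is at most `k` are off `targetMMS` once
`lev(z_c) + k + 1 < 20·r∥ − b₀∥`. [folklore] -/
theorem disjoint_targetMM_of_nearS (c : V) {a' : ℕ} {x : Site 2} {du : MDir} {L' : ℕ} {k Lc : ℤ} {Z : Finset V} (hD : 0 < pr.D)
    (hk : ∀ v ∈ Z, |pr.ψ φ c v du.1| ≤ k) (hLc : P.lev du x (pr.ψ φ w₀ c) ≤ Lc) (hfar : Lc + k + 1 < 20 * (P.r du.1 : ℤ) - b₀ du.1) :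
    Disjoint (targetMMS G φ pr P w₀ Λ b₀ a' x du L') Z := by
  refine Finset.disjoint_right.2 fun v hv hvM => ?_
  rcases Finset.mem_union.1 hvM with h | h
  · simp only [cellGeomSG₂bS_M] at h
    exact not_mem_MbWin_of_nearS P w₀ c pr.A pr.n pr.h pr.vα pr.vβ pr.c₀ pr.c₁ hD (hk v hv) hLc hfar h
  · exact not_mem_MbWinW_of_nearS P w₀ c pr.A pr.n pr.h pr.vα pr.vβ pr.c₀ pr.c₁ hD (hk v hv) hLc hfar (Finset.mem_filter.1 h).1

/-- **FOOTPRINT ⟹ TARGET** for every vertex of the outer ball: near ones (within `rM − L′` of `w₀`, hence within `rM − 1`) land in `M` by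
`mem_Mb_win_of_footBoxS`, far ones in `RimG` (`1 ≤ L′ ≤ rM`). [cite: KozmaNitzan2024, §4 p. 26, p. 30 (Step III)] -/
theorem mem_targetMM_of_footBoxS (c : V) {a' : ℕ} {x : Site 2} {du : MDir} {L' : ℕ} (hL' : 1 ≤ L') (hrM : L' ≤ Λ.rM a' (x + stepVec du))
    (hD : 0 < pr.D) (hlip : Lip G (pr.ψ φ w₀))
    (hws : WeakSteps G (pr.ψ φ w₀)) {glo ghi gw : ℤ} {w : V} (hwB : w ∈ graphBall G w₀ (Λ.rE a' x du))
    (hfb : FootBox glo ghi gw du (pr.ψ φ c w))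
    (hpar : ∀ s : ℤ, glo ≤ s → s ≤ ghi → |sgOf du * s + pr.ψ φ w₀ c du.1 - P.cenS (x + stepVec du) du.1| + 2 ≤ b₀ du.1)
    (hperp : gw + |pr.ψ φ w₀ c (oth du.1) - P.cenS (x + stepVec du) (oth du.1)| + 2 ≤ b₀ (oth du.1)) :
    w ∈ targetMMS G φ pr P w₀ Λ b₀ a' x du L' := by
  by_cases hnear : w ∈ graphBall G w₀ (Λ.rM a' (x + stepVec du) - L')
  · refine Finset.mem_union_left _ ?_
    simp only [cellGeomSG₂bS_M]
    refine mem_Mb_win_of_footBoxS P w₀ c pr.A pr.n pr.h pr.vα pr.vβ pr.c₀ pr.c₁ hD hlip hws (R := Λ.rM a' (x + stepVec du) - L') (by omega)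
      hnear hfb hpar hperp
  · refine Finset.mem_union_right _ (Finset.mem_filter.2 ⟨(mem_Win G _).2 ⟨hwB, ?_⟩, hnear⟩)
    rw [PCells2S.mem_Mb_iff]
    intro i
    have key : |pr.ψ φ w₀ w i - P.cenS (x + stepVec du) i| + 1 ≤ b₀ i :=
      cell_mem_Mb_of_footBoxS (φ := φ) P w₀ c pr.A pr.n pr.h pr.vα pr.vβ pr.c₀ pr.c₁ hD hfb hpar hperp i
    have := abs_le.1 (show |pr.ψ φ w₀ w i - P.cenS (x + stepVec du) i| ≤ b₀ i by linarith)
    constructor <;> linarith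

/-! ## §3 The arrival box's cells, thickened, lie in the far rows -/

/-- **`Mb b₀ (x+du)` thickened transversally by `k₀` lies in `farAS₂ x du j`** (`j + 1 ≤ K`, `b₀∥ + 2 ≤ 5r∥`, `b₀⊥ + k₀ + 3 ≤ 5r⊥`):
the `hPl` input of `Win_subset_stepRgNbS` for the window over the arrival box. [cite: KozmaNitzan2024, §4 p. 26 (M_v ⊆ E_{v,x})] -/
theorem _root_.Summit.CriticalPhenomena.PercolationContinuityZ3.Theorems.Transplant.PCells2S.Mb_thick_mem_farASS₂ (P : PCells2S) {x : Site 2}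
    {du : MDir} {j : ℕ} (hjK : j + 1 ≤ P.K) {b₀ : Fin 2 → ℕ} {k₀ : ℤ} (hbpar : (b₀ du.1 : ℤ) + 2 ≤ 5 * P.r du.1)
    (hbperp : (b₀ (oth du.1) : ℤ) + k₀ + 3 ≤ 5 * P.r (oth du.1)) :
    ∀ z ∈ P.Mb b₀ (x + stepVec du), ∀ z' : Site 2, z' du.1 = z du.1 → |z' (oth du.1) - z (oth du.1)| ≤ k₀ → z' ∈ P.farASS₂ x du j := by
  intro z hz z' hz1 hz2
  have hM := (PCells2S.mem_Mb_iff (P := P)).1 hz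
  have h0 := hM du.1
  have h1 := hM (oth du.1)
  rw [P.cenS_add_stepVec_fst] at h0
  have hz2' := abs_le.1 hz2
  have hsK : (P.s du.1 : ℤ) * (j + 1) ≤ P.r du.1 := by
    have : P.s du.1 * (j + 1) ≤ P.s du.1 * P.K := Nat.mul_le_mul_left _ hjK
    have e : P.r du.1 = P.K * P.s du.1 := rfl
    rw [e]; push_cast; nlinarith
  have hσ := sgOf_sign du
  have hr : (1 : ℤ) ≤ P.r du.1 := by exact_mod_cast P.one_le_r du.1
  refine P.mem_farASS₂_of_bounds_far ?_ ?_ ?_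
  · unfold PCells2S.lev; rw [hz1]; rcases hσ with hs | hs <;> rw [hs] at h0 ⊢ <;> nlinarith
  · unfold PCells2S.lev; rw [hz1]; rcases hσ with hs | hs <;> rw [hs] at h0 ⊢ <;> nlinarith
  · rw [abs_le]; constructor <;> linarith

end Skelφ

end Summit.CriticalPhenomena.PercolationContinuityZ3.Theorems.Transplant

end
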